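import Mathlib
import Summits.KontsevichZagierPeriods.Zeta5Search.RhoResidueIdentitiesProof
import Summits.KontsevichZagierPeriods.Zeta5Search.PalindromeLemma
import HarnessLib

/-!
# ζ(5) search — the REVERSAL IDENTITY `ĉ_{x̄} = (−1)^{E_x+1} ĉ_x` is a THEOREM (`CHatReversal`)

Cell `pub-zeta5` (HONEST FRAMING: systematic search; no irrationality claim unless certified), typer seat
generation 9.  Discharges BY NAME gen-2 g9's reversal identity (R) (`CHatReversal`, `Zeta5Search/UniversalDigit.lean` §3;
REPORT-gen2-g9 §1.5; exact check 104,951 classes): for a class with `E_x ≤ −3` not containing the centre, the `𝒦`-type invariant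
`ĉ_x = Σ_{poles} (ℓ_q² ρ_{q,1} + 2ℓ_q ρ_{q,2})` of the conjugate class `x̄ = conjClass b p x` is `(−1)^{E_x+1} ĉ_x`.

PROOF.  Under the conjugation `q ↦ b₀ − q` the class data reverse: `classCofactor_conj` (`Φ`-cofactor(b₀−q) =
(−1)^{E−e_q}·cofactor(q)(−X)`, as in the palindrome lemma), hence `classRho_conj`: `ρ_{b₀−q,σ} = (−1)^{E+σ} ρ_{q,σ}`; the levels
reverse, `ℓ_{b₀−q} = L − ℓ_q`; expanding `(L − ℓ)²` and `(L − ℓ)` the `L`-terms are `L²·Σρ₁ − 2L·Σ(ρ₂ + ℓρ₁) = 0` by the residue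
identities (`rhoResidueIdentities_holds`, typer g9).  Pure algebra; nothing about irrationality.
-/

noncomputable section

open Finset PowerSeries

namespace Summit.KontsevichZagierPeriods.Zeta5Search.ClusterValuation

open Summit.KontsevichZagierPeriods.Zeta5Search.DualSeries (InBox)
open Summit.KontsevichZagierPeriods.Zeta5Search.CasoratianValuation (InPolytope)

/-! ### The class data under conjugation -/

/-- The points of the conjugate class of a class point `q` are the reflections of the class of `q`. -/
theorem classSet_reflect_point (b : ℕ → ℤ) {p x q : ℕ} (hx : x ≤ (b 0).toNat) (hq : q ∈ classSet b p x) :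
    classSet b p ((b 0).toNat - q) = (classSet b p x).image (fun s => (b 0).toNat - s) := by
  have hqn := le_of_mem_classSet b hq
  have hmem : (b 0).toNat - q ∈ classSet b p (conjClass b p x) :=
    (mem_classSet_conj_iff b hx (by omega)).2 (by rwa [Nat.sub_sub_self hqn])
  rw [classSet_eq_of_mem hmem, classSet_conj b hx]

/-- **The cofactor at the conjugate pole** (class without centre): `cofactor(b₀ − q) = (−1)^{E_x − e_q} · cofactor(q)(−X)`. -/
theorem classCofactor_conj (b : ℕ → ℤ) (h0 : 0 ≤ b 0) {p x q : ℕ} (hx : x ≤ (b 0).toNat)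
    (hcx : ¬ CentreIn b p x) (hq : q ∈ classSet b p x) :
    classCofactor b p ((b 0).toNat - q) = C ((-1 : ℚ) ^ (classExp b p x - netExp b q)) * rescale (-1) (classCofactor b p q) := by
  set n := (b 0).toNat with hn
  have hqn : q ≤ n := le_of_mem_classSet b hq
  have hm1 : (-1 : ℚ) ≠ 0 := by norm_num
  have hCq : classSet b p q = classSet b p x := classSet_eq_of_mem hq
  have hCq' := classSet_reflect_point b hx hq
  -- no centre factors
  have hc1 : ¬ (¬ (2 : ℤ) ∣ b 0 ∧ CentreIn b p q) := fun h => hcx ((centreIn_iff_of_mem hq).1 h.2)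
  have hmem' : n - q ∈ classSet b p (conjClass b p x) :=
    (mem_classSet_conj_iff b hx (by omega)).2 (by rwa [Nat.sub_sub_self hqn])
  have hc2 : ¬ (¬ (2 : ℤ) ∣ b 0 ∧ CentreIn b p (n - q)) := fun h =>
    hcx ((centreIn_conj_iff b h0 hx).1 ((centreIn_iff_of_mem hmem').1 h.2))
  -- the erased reflected class
  have herase : (classSet b p (n - q)).erase (n - q) = ((classSet b p x).erase q).image (fun s => n - s) := by
    rw [hCq']
    ext s'
    simp only [mem_erase, mem_image]
    constructor
    · rintro ⟨hne, s, hs, rfl⟩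
      exact ⟨s, ⟨fun h => hne (by rw [h]), hs⟩, rfl⟩
    · rintro ⟨s, ⟨hsq, hs⟩, rfl⟩
      have hsn := le_of_mem_classSet b hs
      exact ⟨fun h => hsq (by omega), s, hs, rfl⟩
  unfold classCofactor
  rw [if_neg hc1, if_neg hc2, mul_one, mul_one, hCq, herase,
    prod_image (fun s hs t ht h => reflect_injOn b (mem_of_mem_erase hs) (mem_of_mem_erase ht) h)]
  -- factorwise
  have hfac : ∀ s ∈ (classSet b p x).erase q,
      binomSeries ((((n - q : ℕ) : ℚ) - ((n - s : ℕ) : ℚ)) / p) (netExp b (n - s)) =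
        C ((-1 : ℚ) ^ netExp b s) * rescale (-1) (binomSeries (((q : ℚ) - s) / p) (netExp b s)) := by
    intro s hs
    have hsn : s ≤ n := le_of_mem_classSet b (mem_of_mem_erase hs)
    rw [netExp_reflect b h0 hsn, show (((n - q : ℕ) : ℚ) - ((n - s : ℕ) : ℚ)) / p = -(((q : ℚ) - s) / p) by
      rw [Nat.cast_sub hqn, Nat.cast_sub hsn]; ring, binomSeries_neg_base]
  rw [prod_congr rfl hfac, prod_mul_distrib, ← map_prod, prod_zpow_eq _ _ hm1, ← map_prod]
  have hnear := nearExp_eq b (p := p) hqn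
  rw [if_neg hc1, add_zero, hCq, classExp_eq_of_mem hq] at hnear
  rw [hnear]

/-- **`ρ_{b₀−q,σ} = (−1)^{E_x+σ} ρ_{q,σ}`** under conjugation (class without centre, `σ ≤ n_q`). -/
theorem classRho_conj (b : ℕ → ℤ) (h0 : 0 ≤ b 0) {p x q : ℕ} (hx : x ≤ (b 0).toNat)
    (hcx : ¬ CentreIn b p x) (hq : q ∈ classSet b p x) {σ : ℕ} (hσ : (σ : ℤ) ≤ -netExp b q) :
    classRho b p ((b 0).toNat - q) σ = (-1 : ℚ) ^ (classExp b p x + σ) * classRho b p q σ := by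
  have hm1 : (-1 : ℚ) ≠ 0 := by norm_num
  unfold classRho
  rw [netExp_reflect b h0 (le_of_mem_classSet b hq), classCofactor_conj b h0 hx hcx hq, coeff_C_mul, coeff_rescale,
    ← mul_assoc, ← zpow_natCast, ← zpow_add₀ hm1]
  congr 1
  have hκ : (((-netExp b q).toNat - σ : ℕ) : ℤ) = -netExp b q - σ := by omega
  rw [hκ, show classExp b p x - netExp b q + (-netExp b q - σ) = (classExp b p x + σ) + 2 * (-netExp b q - σ) by ring,
    neg_one_zpow_add_two_mul]

/-- The levels reverse under conjugation: `ℓ_{b₀−q} + ℓ_q = L := ⌊(b₀ − (x mod p))/p⌋`. -/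
theorem lvl_reflect_add (b : ℕ → ℤ) {p x q : ℕ} (hp : 0 < p) (hq : q ∈ classSet b p x) :
    ((b 0).toNat - q) / p + q / p = ((b 0).toNat - x % p) / p := by
  have hqn := le_of_mem_classSet b hq
  have hres : q % p = x % p := (mem_filter.1 hq).2
  have hdm := Nat.div_add_mod q p
  have : (b 0).toNat - x % p = ((b 0).toNat - q) + p * (q / p) := by omega
  rw [this, Nat.add_mul_div_left _ _ hp]

/-! ### The reversal identity -/

/-- **`CHatReversal` is a theorem.** -/
theorem cHatReversal_holds : CHatReversal := by
  intro b p x hb hprime hp5 hwin hx hE hcx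
  have hp0 : 0 < p := hprime.pos
  have h0 : 0 ≤ b 0 := hb.1.1
  set n := (b 0).toNat with hn
  -- the class has a pole, so `x ≤ b₀`
  have hxn : x ≤ n := by
    by_contra hlt
    push Not at hlt
    have hempty : classSet b p x = ∅ := by
      apply eq_empty_of_forall_notMem
      intro s hs
      obtain ⟨hsn, hres⟩ := mem_filter.1 hs
      rw [mem_range] at hsn
      rw [Nat.mod_eq_of_lt hx] at hres
      have : s % p = s := Nat.mod_eq_of_lt (by omega)
      omega
    have : 0 ≤ classExp b p x := by
      unfold classExp; rw [hempty, sum_empty]; split_ifs <;> norm_num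
    omega
  obtain ⟨hS1, hS2, -⟩ := rhoResidueIdentities_holds b p x hb hprime hp5 hwin hx
  have hS1' := hS1 (by omega)
  have hS2' := hS2 hE
  -- the poles of the conjugate class
  have hpoles : classPoles b p (conjClass b p x) = (classPoles b p x).image (fun s => n - s) := by
    unfold classPoles
    rw [classSet_conj b hxn, filter_image]
    exact congrArg _ (filter_congr fun s hs => by
      show netExp b (n - s) < 0 ↔ netExp b s < 0
      rw [netExp_reflect b h0 (le_of_mem_classSet b hs)])
  have hinj : Set.InjOn (fun s => n - s) ↑(classPoles b p x) :=
    (reflect_injOn b).mono (coe_subset.2 (filter_subset _ _))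
  unfold cHat
  rw [hpoles, sum_image hinj]
  -- termwise, with the reversed levels and the sign rule
  set L := ((n - x % p) / p : ℕ) with hL
  set sgn := (-1 : ℚ) ^ (classExp b p x + 1) with hsgn
  have hterm : ∀ q ∈ classPoles b p x,
      (((((n - q) / p : ℕ) : ℚ)) ^ 2 * classRho b p (n - q) 1 +
        (if netExp b (n - q) ≤ -2 then 2 * (((n - q) / p : ℕ) : ℚ) * classRho b p (n - q) 2 else 0)) =
      sgn * ((((q / p : ℕ) : ℚ)) ^ 2 * classRho b p q 1 +
        (if netExp b q ≤ -2 then 2 * ((q / p : ℕ) : ℚ) * classRho b p q 2 else 0)) +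
      sgn * ((L : ℚ) ^ 2 * classRho b p q 1 -
        2 * (L : ℚ) * ((if netExp b q ≤ -2 then classRho b p q 2 else 0) + ((q / p : ℕ) : ℚ) * classRho b p q 1)) := by
    intro q hq
    obtain ⟨hqC, hqpole⟩ := mem_filter.1 hq
    have hlv : ((((n - q) / p : ℕ) : ℚ)) = (L : ℚ) - ((q / p : ℕ) : ℚ) := by
      have := lvl_reflect_add b hp0 hqC
      rw [← hL] at this
      have h' : ((((n - q) / p : ℕ) : ℚ)) + ((q / p : ℕ) : ℚ) = (L : ℚ) := by exact_mod_cast this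
      linarith
    rw [netExp_reflect b h0 (le_of_mem_classSet b hqC), hlv, classRho_conj b h0 hxn hcx hqC (by omega)]
    have hs2 : (-1 : ℚ) ^ (classExp b p x + ((1 : ℕ) : ℤ)) = sgn := by rw [hsgn]; norm_num
    rw [hs2]
    by_cases h2 : netExp b q ≤ -2
    · rw [if_pos h2, if_pos h2, if_pos h2, classRho_conj b h0 hxn hcx hqC (by push_cast; omega),
        show (-1 : ℚ) ^ (classExp b p x + ((2 : ℕ) : ℤ)) = -sgn by
          rw [hsgn, show classExp b p x + ((2 : ℕ) : ℤ) = (classExp b p x + 1) + 1 by push_cast; ring,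
            zpow_add_one₀ (by norm_num : (-1 : ℚ) ≠ 0)]; ring]
      ring
    · rw [if_neg h2, if_neg h2, if_neg h2]
      ring
  rw [sum_congr rfl hterm, sum_add_distrib, ← mul_sum, ← mul_sum]
  have hLterm : ∑ q ∈ classPoles b p x, ((L : ℚ) ^ 2 * classRho b p q 1 -
      2 * (L : ℚ) * ((if netExp b q ≤ -2 then classRho b p q 2 else 0) + ((q / p : ℕ) : ℚ) * classRho b p q 1)) = 0 := by
    rw [sum_sub_distrib, ← mul_sum, ← mul_sum, hS1', hS2']; ring
  rw [hLterm, mul_zero, add_zero]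

end Summit.KontsevichZagierPeriods.Zeta5Search.ClusterValuation

end
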